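import Summits.Ventures.HodgeRepro2.T5SU11JacobiPhaseOrbitCovariance

/-!
# The correlation coefficient of the phase and the orbit radius at `λ = 0` is `√(1 − 4/k²)`

At `λ = 0` everything is explicit: the phase is `Exp(k − 2)` (variance `1/(k − 2)²`, `T5SU11JacobiPhaseMoments`),
the squared orbit radius has variance `r_k(0)(r_{k+2}(0) − r_k(0)) = 4(k − 2)/(k²(k + 2))` (`T5SU11JacobiPhaseMGF`,
`r_k(0) = (k − 2)/k`), and the covariance is `2/k²` (`T5SU11JacobiPhaseOrbitCovariance`). Hence

  **`ρ_k(0) = Cov_{k,0}(log|a|, |g·0|²) / √(Var_{k,0}(log|a|) Var_{k,0}(|g·0|²)) = √(1 − 4/k²)`**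
  (`correlation_phase_orbit_sq_zero`; `variance_phase_zero`, `variance_orbit_sq_zero`),

for every `k > 2`: the two coordinates of the explicit model at `λ = 0` have correlation coefficient
`√(1 − 4/k²) = √((k − 2)(k + 2))/k`, which increases from `0` (at the border weight `k = 2`) to `1` — the exact
form of the asymptotic perfect correlation of `T5SU11JacobiPhaseOrbitCovarianceAsymptotic` at `λ = 0`, with
`1 − ρ_k(0)² = 4/k²` exactly. Nothing is claimed about (N).

Blind lane: Mathlib + the HodgeRepro2 prefix only; no sorry; axioms ⊆ {propext, Classical.choice,
Quot.sound}.
-/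

namespace Summit.Ventures.HodgeRepro2.T5SU11JacobiPhaseOrbitCorrelationZero

open MeasureTheory MeasureTheory.Measure Metric Set Filter Topology
open T5SU11Unimodular T5SU11Fibration T5SU11Cartan T5SU11CartanProjection T5HaarCircle
  T5BergmanCoefficient T5SU11FibrationHaar T5SU11SphericalFunction T5SU11SphericalSymmetry
  T5SU11SphericalBounds T5SU11SphericalContinuous T5SU11JacobiIwasawa T5SU11JacobiTransform
  T5SU11JacobiWeight T5SU11KFiniteMajorantPow T5SU11JacobiWeightDeriv T5SU11JacobiWeightRecursion
  T5SU11JacobiPhaseMGF T5SU11JacobiPhaseMoments T5SU11JacobiPhaseOrbitCovariance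
open scoped Real

section measure

variable [MeasurableSpace Circle] [BorelSpace Circle]

/-- **The variance of the phase at `λ = 0` is `1/(k − 2)²`**, in the transform's own notation. -/
theorem variance_phase_zero {k : ℝ} (hk : 2 < k) :
    (∫ g, Real.log ‖mat g 0 0‖ ^ 2 * ((1 - ‖orbit g‖ ^ 2) ^ (k / 2) * sph 0 g) ∂(nu haarCircle))
        / (∫ g, (1 - ‖orbit g‖ ^ 2) ^ (k / 2) * sph 0 g ∂(nu haarCircle))
      - ((∫ g, Real.log ‖mat g 0 0‖ * ((1 - ‖orbit g‖ ^ 2) ^ (k / 2) * sph 0 g) ∂(nu haarCircle))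
        / (∫ g, (1 - ‖orbit g‖ ^ 2) ^ (k / 2) * sph 0 g ∂(nu haarCircle))) ^ 2
      = 1 / (k - 2) ^ 2 := by
  simp_rw [sph_zero, mul_one]
  rw [integral_sq_log_norm_mat_mul_orbit_rpow hk, integral_log_norm_mat_mul_orbit_rpow hk,
    integral_orbit_rpow_nu hk]
  have hk2 : k - 2 ≠ 0 := by
    intro h
    linarith
  have hpi : (π : ℝ) ≠ 0 := Real.pi_ne_zero
  field_simp
  ring

/-- **The variance of the squared orbit radius at `λ = 0` is `4(k − 2)/(k²(k + 2))`**. -/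
theorem variance_orbit_sq_zero {k : ℝ} (hk : 2 < k) :
    (∫ g, (‖orbit g‖ ^ 2) ^ 2 * ((1 - ‖orbit g‖ ^ 2) ^ (k / 2) * sph 0 g) ∂(nu haarCircle))
        / (∫ g, (1 - ‖orbit g‖ ^ 2) ^ (k / 2) * sph 0 g ∂(nu haarCircle))
      - ((∫ g, ‖orbit g‖ ^ 2 * ((1 - ‖orbit g‖ ^ 2) ^ (k / 2) * sph 0 g) ∂(nu haarCircle))
        / (∫ g, (1 - ‖orbit g‖ ^ 2) ^ (k / 2) * sph 0 g ∂(nu haarCircle))) ^ 2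
      = 4 * (k - 2) / (k ^ 2 * (k + 2)) := by
  rw [variance_orbit_sq_eq (by linarith) (by linarith) (by linarith), weightRatio_eq (by linarith),
    weightRatio_eq (by linarith : k + 2 ≠ 0)]
  have hk0 : k ≠ 0 := by linarith
  have hk2 : k + 2 ≠ 0 := by linarith
  field_simp
  ring

/-- **THE CORRELATION COEFFICIENT AT `λ = 0`**: for `k > 2`,
`Cov_{k,0}(log|a|, |g·0|²) / √(Var_{k,0}(log|a|) Var_{k,0}(|g·0|²)) = √(1 − 4/k²)`. -/
theorem correlation_phase_orbit_sq_zero {k : ℝ} (hk : 2 < k) :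
    ((∫ g, Real.log ‖mat g 0 0‖ * ‖orbit g‖ ^ 2 * ((1 - ‖orbit g‖ ^ 2) ^ (k / 2) * sph 0 g)
            ∂(nu haarCircle))
          / (∫ g, (1 - ‖orbit g‖ ^ 2) ^ (k / 2) * sph 0 g ∂(nu haarCircle))
        - ((∫ g, Real.log ‖mat g 0 0‖ * ((1 - ‖orbit g‖ ^ 2) ^ (k / 2) * sph 0 g) ∂(nu haarCircle))
            / (∫ g, (1 - ‖orbit g‖ ^ 2) ^ (k / 2) * sph 0 g ∂(nu haarCircle)))
          * ((∫ g, ‖orbit g‖ ^ 2 * ((1 - ‖orbit g‖ ^ 2) ^ (k / 2) * sph 0 g) ∂(nu haarCircle))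
            / (∫ g, (1 - ‖orbit g‖ ^ 2) ^ (k / 2) * sph 0 g ∂(nu haarCircle))))
      / Real.sqrt
        (((∫ g, Real.log ‖mat g 0 0‖ ^ 2 * ((1 - ‖orbit g‖ ^ 2) ^ (k / 2) * sph 0 g) ∂(nu haarCircle))
            / (∫ g, (1 - ‖orbit g‖ ^ 2) ^ (k / 2) * sph 0 g ∂(nu haarCircle))
          - ((∫ g, Real.log ‖mat g 0 0‖ * ((1 - ‖orbit g‖ ^ 2) ^ (k / 2) * sph 0 g) ∂(nu haarCircle))
            / (∫ g, (1 - ‖orbit g‖ ^ 2) ^ (k / 2) * sph 0 g ∂(nu haarCircle))) ^ 2)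
        * ((∫ g, (‖orbit g‖ ^ 2) ^ 2 * ((1 - ‖orbit g‖ ^ 2) ^ (k / 2) * sph 0 g) ∂(nu haarCircle))
            / (∫ g, (1 - ‖orbit g‖ ^ 2) ^ (k / 2) * sph 0 g ∂(nu haarCircle))
          - ((∫ g, ‖orbit g‖ ^ 2 * ((1 - ‖orbit g‖ ^ 2) ^ (k / 2) * sph 0 g) ∂(nu haarCircle))
            / (∫ g, (1 - ‖orbit g‖ ^ 2) ^ (k / 2) * sph 0 g ∂(nu haarCircle))) ^ 2))
      = Real.sqrt (1 - 4 / k ^ 2) := by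
  rw [covariance_phase_orbit_sq_zero hk, variance_phase_zero hk, variance_orbit_sq_zero hk]
  have hk0 : 0 < k := by linarith
  have hr : 0 < k - 2 := by linarith
  have hX : 0 < 1 / (k - 2) ^ 2 * (4 * (k - 2) / (k ^ 2 * (k + 2))) := by positivity
  have h1 : 0 ≤ 1 - 4 / k ^ 2 := by
    rw [sub_nonneg, div_le_one (by positivity)]
    nlinarith
  have key : Real.sqrt (1 - 4 / k ^ 2) * Real.sqrt (1 / (k - 2) ^ 2 * (4 * (k - 2) / (k ^ 2 * (k + 2))))
      = 2 / k ^ 2 := by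
    rw [← Real.sqrt_mul h1, show (1 - 4 / k ^ 2) * (1 / (k - 2) ^ 2 * (4 * (k - 2) / (k ^ 2 * (k + 2))))
        = (2 / k ^ 2) ^ 2 by
      have hk2 : k + 2 ≠ 0 := by linarith
      field_simp
      ring, Real.sqrt_sq (by positivity)]
  rw [eq_comm, eq_div_iff (Real.sqrt_pos.mpr hX).ne']
  exact key

end measure

end Summit.Ventures.HodgeRepro2.T5SU11JacobiPhaseOrbitCorrelationZero
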